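import Summits.QuantumFields.BalabanUV.Beta.FP.PerfectFullSandwich

/-!
# `BalabanUV.Beta.FP.GenericResolventSandwich` — road «FP» for binder row D1, ruling R-FP-40 (located question «AXIAL vs SYM dressing», owner memo
# `HOME/b2b-balaban-beta-d1-p3/AXIAL-VS-SYM.md`): THE N0-SANDWICH OF ROAD FP OVER A GENERIC LEG `G` AND A GENERIC COLUMN KERNEL `K` —
# `hessKer G (vertexOfK K n S) (vertex2OfK K n Wf) μ ν z = dressedEntryP (c a ↦ colH K n a 0 c) (fineHessA G S Wf) (n•(−z)) μ ν`,
# of which the landed AXIAL sandwich `PerfectFullSandwich.TPerfOf_vertex2OfK_eq_dressedEntryP` is the instance `(G, S) := (Π K Π, Πᵀ S)` and the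
# (0.4) LITERAL OF RECORD's shape `TbalOf Lc (JsB12Sym …) j = hessKer G_j (vertexOfK G_j Lc S⁰_j) W⁰_j` (an2 `SymmetrisedDressingHessian.TbalOf_dressSymAt`,
# `G_j = coDressKSymAt ρ_c Lc (KInvStep Lc j)`) is the instance `K := G` (ONE kernel: leg = column kernel, NO projector on the stencils)

HONEST DEPENDENCY (page 1, mandatory): continuum YM on T⁴ ⇐ BetaPertH ∧ nine spine estimates (0/9 proved); BetaPertH ⇐ (D1) ∧ (D4) ∧ CAP+tail;
G-an2-4 gates asym, D1 and NE2/3/4.  HONEST FRAMING (cell contract, verbatim): «discharging `BetaPertH` makes Bałaban's UV stability UNCONDITIONAL —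
a real constructive-QFT result; it is NOT the continuum limit and NOT the Clay problem.»  THIS MODULE DISCHARGES NOTHING of the wall: it is [folklore]
re-indexing of absolutely convergent double superpositions (`PerfectFullSandwich.tadpole_vertex2OfK`, `PerfectBubbleExpansion.bubble_vertexOfK` — both
already stated for a generic spread leg and a generic decaying column kernel — + block periodicity of the fine tables from coarse covariance +
`ReducedKernelSandwich.dressedEntryP_add`), i.e. the landed axial proof with `Π K Π ↦ G`, `Πᵀ S ↦ S`.  No `def`, no `def … : Prop`, nothing cited, 0 sorry;
0∕4 row-D1 binders; NOT (ASYMP), NOT D1, NOT BetaPertH, NOT continuum, NOT Clay.  «not in print; our bookkeeping».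
ABSOLUTE RULE (cell charter, verbatim): «No internally-minted statement may enter as a cited fact. Every hypothesis is either kernel-proved in this package or a
verbatim quotation of a PUBLISHED theorem with page reference. The manuscript(s) under audit are NOT citable for their own disputed steps — they are the thing
under adjudication; programme-internal (2001/route/tribunal) claims are never citable.»

WHY (R-FP-40, located): road FP's perfect one-loop kernel `PerfectObjectsT.TPerfOf n K S W := hessKer (axDressK n K) (axVertexOfK K n S) W` hard-codes the
AXIAL dressing (`Π K Π`, `Πᵀ` on the bond slot), the shape of the axial wall family `TbalOf_JsBalOf`; the literal of record since R-D1-g25-1 is the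
SYMMETRISED family `JsB12Sym = dressSymAt ρ_c ∘ JsB12Sym0`, whose kernels are `hessKer G_j (vertexOfK G_j Lc S⁰_j) W⁰_j` with the dressing INSIDE the
resolvent `G_j = Π̂ᵀ_sym K_j Π̂_sym`.  Everything road FP does BELOW the sandwich (fine tables `fineHessA`, far∕near split, (LEDGER), H2V-4, the BF capstone)
is stated for an abstract leg∕stencil∕table triple, and (E) `FineSplitJunction.hasym_of_fineSplit` takes the sandwich identity as the HYPOTHESIS `hsand`
with an ABSTRACT kernel family `T m`; so the scheme enters road FP through exactly two doors: THIS sandwich (now generic) and the COLUMN LETTERS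
(L0∞)(L1∞)(AbsMoment₂), which (E) and `RemainderLedgerCov` consume at `colOf (KPerf … m)` (the undressed perfect column — correct for the axial placement,
to be re-supplied at the co-dressed perfect column for the literal: instance row «COL-SYM» of `RESIDUAL-FP.md` §10, not this file).

WHAT.  §1 [folklore] `tadpolePart_eq_dressedEntryP` — `½·tadpole G (vertex2OfK K n Wf μ 0 ν z) = dressedEntryP (colH K n · 0 ·) (tadpoleTableA G Wf) (n•(−z)) μ ν`
(spread block-covariant `G`; decaying block-covariant `K`; bi-localised block-covariant `Wf`); `bubblePart_eq_dressedEntryP` — the bubble half likewise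
(local block-covariant `S`); **`hessKer_vertexOfK_vertex2OfK_eq_dressedEntryP`** — the whole kernel (needs the `AbsMoment₂` letter of `colOf K` for the
additivity of the sandwich).  §2 [folklore] THE TWO INSTANCES: `TPerfOf_eq_hessKer_coProj` (`TPerfOf n K S W = hessKer (Π K Π) (vertexOfK K n (Πᵀ S)) W`,
`AxialDressing.vertexOfK_coProj_eq`) — so the axial sandwich is §1 at `(G, S) := (axDressK n K, coProj n S)`; **`hessKer_self_eq_dressedEntryP`** — §1 at
`K := G` for any decaying block-covariant `G` with `AbsMoment₂` columns: the literal of record's placement.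
Provenance: road FP OWNER b2b-balaban-beta-d1-p3 gen 10 (prover-b2b-balaban-beta-d1-p3-g10-0), 2026-08-21, ruling R-FP-40.
-/

noncomputable section

namespace Summit.QuantumFields.BalabanUV.Beta.FP.GenericResolventSandwich

open Finset
open scoped BigOperators
open Literature.MathematicalPhysics.QuantumFieldTheory.Balaban1983to89
open Literature.MathematicalPhysics.QuantumFieldTheory.Balaban1983to89.Beta
open ExpKernelCalculus (Site MKer Decays BiLoc comp tr bubble tadpole hessKer shiftK)
open DecimatedMomentSummable (AbsMoment₂)
open OneStepResolventKernel (Fib wsum LocStencil)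
open OneStepKernelFamily (colH vertexOfK)
open SecondOrderResponse (vertex2OfK)
open AxialProjector (coProj)
open AxialDressing (axDressK axVertexOfK vertexOfK_coProj_eq)
open Summit.QuantumFields.BalabanUV.Beta.TameKernelCalculus
open Summit.QuantumFields.BalabanUV.Beta.D1BFx.MomentTransferPeriodic (IsBlockPeriodic baseKer)
open Summit.QuantumFields.BalabanUV.Beta.D1BFx.MomentTransferPeriodicSum (dressedSumP)
open Summit.QuantumFields.BalabanUV.Beta.D1BFx.MomentTransferPeriodicEntry (EKer₂ dressedEntryP)
open Summit.QuantumFields.BalabanUV.Beta.D1BFx.ReducedKernelSandwich (dressedEntryP_add)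
open Summit.QuantumFields.BalabanUV.Beta.D1BFx.DressedTablesLeg (bubbleTableA bubbleTableA_apply tadpoleTableA tadpoleTableA_apply
  absMoment₂_baseKer_bubbleTableA absMoment₂_baseKer_tadpoleTableA)
open Summit.QuantumFields.BalabanUV.Beta.D1BFx.ReducedKernelSandwichLeg (fineHessA)
open Summit.QuantumFields.BalabanUV.Beta.FP.PerfectObjectsT (TPerfOf)
open Summit.QuantumFields.BalabanUV.Beta.FP.TransportInfinityM (colOf)
open Summit.QuantumFields.BalabanUV.Beta.FP.PerfectBubbleExpansion (bubble_vertexOfK colH_of_blockCov)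
open Summit.QuantumFields.BalabanUV.Beta.FP.PerfectBubbleSandwich (isBlockPeriodic_bubbleTableA_coarse absMoment₂_colH_zero)
open Summit.QuantumFields.BalabanUV.Beta.FP.PerfectFullSandwich (tadpole_vertex2OfK isBlockPeriodic_tadpoleTableA_coarse)

/-! ## §1 The sandwich over a generic leg `G` with the columns of a generic kernel `K` -/

section Sandwich

variable {n : ℕ} {G K : MKer (3 + 1) (Fib 3)} {C δ : ℝ} {S : Fin (3 + 1) → (Fin (3 + 1) → ℤ) → MKer (3 + 1) (Fib 3)} {Cs δs : ℝ}
  {Wf : Fin (3 + 1) → (Fin (3 + 1) → ℤ) → Fin (3 + 1) → (Fin (3 + 1) → ℤ) → MKer (3 + 1) (Fib 3)} {C2 δ2 : ℝ}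

/-- [folklore] **THE TADPOLE HALF OVER A GENERIC LEG**: spread, coarse-translation-invariant leg `G`; decaying, coarse-translation-invariant column
kernel `K`; bi-localised, coarse-covariant `Wf`; `1 ≤ n` ⟹
`½·tadpole G (vertex2OfK K n Wf μ 0 ν z) = dressedEntryP (c a ↦ colH K n a 0 c) (tadpoleTableA G Wf) (n•(−z)) μ ν`
(`PerfectFullSandwich.tadpolePart_TPerfOf_eq_dressedEntryP` with `Π K Π ↦ G`). -/
theorem tadpolePart_eq_dressedEntryP (hG : Spr G) (hGcov : ∀ t : Fin (3 + 1) → ℤ, shiftK (-((n : ℤ) • t)) G = G)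
    (hK : Decays K C δ) (hδ : 0 < δ) (hKcov : ∀ t : Fin (3 + 1) → ℤ, shiftK (-((n : ℤ) • t)) K = K)
    (hW : ∀ κ' u l' u', BiLoc (Wf κ' u l' u') u u' C2 δ2) (hδ2 : 0 < δ2)
    (hWcov : ∀ κ' u l' u' t, Wf κ' (u + (n : ℤ) • t) l' (u' + (n : ℤ) • t) = shiftK (-((n : ℤ) • t)) (Wf κ' u l' u'))
    (μ ν : Fin (3 + 1)) (z : Fin (3 + 1) → ℤ) :
    (1 / 2 : ℝ) * tadpole G (vertex2OfK K n Wf μ 0 ν z)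
      = dressedEntryP (fun c a => colH K n a 0 c) (tadpoleTableA G Wf) ((n : ℤ) • (-z)) μ ν := by
  rw [tadpole_vertex2OfK hG hK hδ hW hδ2 μ 0 ν z, Finset.mul_sum]
  simp only [dressedEntryP, dressedSumP]
  refine Finset.sum_congr rfl fun κ' _ => ?_
  rw [Finset.mul_sum]
  refine Finset.sum_congr rfl fun l' _ => ?_
  rw [← tsum_mul_left, ← (Equiv.prodCongr (Equiv.refl (Fin (3 + 1) → ℤ)) (Equiv.addRight ((n : ℤ) • z))).tsum_eq]
  refine tsum_congr fun q => ?_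
  obtain ⟨u, x⟩ := q
  simp only [Equiv.prodCongr_apply, Prod.map_apply, Equiv.refl_apply, Equiv.coe_addRight]
  have hper := isBlockPeriodic_tadpoleTableA_coarse hGcov hWcov κ' l' (-z) u (x + (n : ℤ) • z)
  rw [tadpoleTableA_apply, tadpoleTableA_apply, smul_neg, show x + (n : ℤ) • z + -((n : ℤ) • z) = x by abel] at hper
  rw [colH_of_blockCov hKcov ν z l' (x + (n : ℤ) • z), add_sub_cancel_right, tadpoleTableA_apply,
    show (n : ℤ) • -z + u = u + -((n : ℤ) • z) by rw [smul_neg]; abel, hper]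
  ring

/-- [folklore] **THE BUBBLE HALF OVER A GENERIC LEG**: spread, coarse-translation-invariant `G`; decaying, coarse-translation-invariant `K`; local,
coarse-covariant `S` ⟹ `−½·bubble G (vertexOfK K n S μ 0) (vertexOfK K n S ν z) = dressedEntryP (c a ↦ colH K n a 0 c) (bubbleTableA G S) (n•(−z)) μ ν`
(ALG-1 `PerfectBubbleExpansion.bubble_vertexOfK` + `PerfectBubbleSandwich.bubblePart_TPerfOf_eq_dressedEntryP`'s re-indexing with `Π K Π ↦ G`, `Πᵀ S ↦ S`). -/
theorem bubblePart_eq_dressedEntryP (hG : Spr G) (hGcov : ∀ t : Fin (3 + 1) → ℤ, shiftK (-((n : ℤ) • t)) G = G)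
    (hK : Decays K C δ) (hδ : 0 < δ) (hKcov : ∀ t : Fin (3 + 1) → ℤ, shiftK (-((n : ℤ) • t)) K = K)
    (hS : LocStencil S Cs δs) (hδs : 0 < δs) (hScov : ∀ κ u t, S κ (u + (n : ℤ) • t) = shiftK (-((n : ℤ) • t)) (S κ u))
    (μ ν : Fin (3 + 1)) (z : Fin (3 + 1) → ℤ) :
    -(1 / 2 : ℝ) * bubble G (vertexOfK K n S μ 0) (vertexOfK K n S ν z)
      = dressedEntryP (fun c a => colH K n a 0 c) (bubbleTableA G S) ((n : ℤ) • (-z)) μ ν := by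
  rw [bubble_vertexOfK hG hK hδ hS hδs μ ν 0 z, Finset.mul_sum]
  simp only [dressedEntryP, dressedSumP]
  refine Finset.sum_congr rfl fun κ' _ => ?_
  rw [Finset.mul_sum]
  refine Finset.sum_congr rfl fun l' _ => ?_
  rw [← tsum_mul_left, ← (Equiv.prodCongr (Equiv.refl (Fin (3 + 1) → ℤ)) (Equiv.addRight ((n : ℤ) • z))).tsum_eq]
  refine tsum_congr fun q => ?_
  obtain ⟨u, x⟩ := q
  simp only [Equiv.prodCongr_apply, Prod.map_apply, Equiv.refl_apply, Equiv.coe_addRight]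
  have hper := isBlockPeriodic_bubbleTableA_coarse hGcov hScov κ' l' (-z) u (x + (n : ℤ) • z)
  rw [bubbleTableA_apply, bubbleTableA_apply, smul_neg, show x + (n : ℤ) • z + -((n : ℤ) • z) = x by abel] at hper
  rw [colH_of_blockCov hKcov ν z l' (x + (n : ℤ) • z), add_sub_cancel_right, bubbleTableA_apply,
    show (n : ℤ) • -z + u = u + -((n : ℤ) • z) by rw [smul_neg]; abel, hper]
  ring

/-- [folklore] **THE ONE-LOOP KERNEL OVER A GENERIC LEG WITH THE BI-VERTEX IN THE SECOND-ORDER SLOT IS A SANDWICH OF THE FULL FINE KERNEL**: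
`hessKer G (vertexOfK K n S) (vertex2OfK K n Wf) μ ν z = dressedEntryP (c a ↦ colH K n a 0 c) (fineHessA G S Wf) (n•(−z)) μ ν`
(§1's two halves + `dressedEntryP_add`, which needs the absolutely summable second moments of the columns `colOf K`). -/
theorem hessKer_vertexOfK_vertex2OfK_eq_dressedEntryP (hn : 1 ≤ n) (hG : Spr G) (hGcov : ∀ t : Fin (3 + 1) → ℤ, shiftK (-((n : ℤ) • t)) G = G)
    (hK : Decays K C δ) (hδ : 0 < δ) (hKcov : ∀ t : Fin (3 + 1) → ℤ, shiftK (-((n : ℤ) • t)) K = K)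
    (hwA : ∀ κ l : Fin 4, AbsMoment₂ (colOf K κ l))
    (hS : LocStencil S Cs δs) (hδs : 0 < δs) (hScov : ∀ κ u t, S κ (u + (n : ℤ) • t) = shiftK (-((n : ℤ) • t)) (S κ u))
    (hW : ∀ κ' u l' u', BiLoc (Wf κ' u l' u') u u' C2 δ2) (hδ2 : 0 < δ2)
    (hWcov : ∀ κ' u l' u' t, Wf κ' (u + (n : ℤ) • t) l' (u' + (n : ℤ) • t) = shiftK (-((n : ℤ) • t)) (Wf κ' u l' u'))
    (μ ν : Fin (3 + 1)) (z : Fin (3 + 1) → ℤ) :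
    hessKer G (vertexOfK K n S) (vertex2OfK K n Wf) μ ν z
      = dressedEntryP (fun c a => colH K n a 0 c) (fineHessA G S Wf) ((n : ℤ) • (-z)) μ ν := by
  have hS' : ∀ κ u, BiLoc (S κ u) u u Cs δs := fun κ u => hS κ u
  have hadd := dressedEntryP_add (N := n) (by omega) (fun c a => colH K n a 0 c) (tadpoleTableA G Wf) (bubbleTableA G S)
    (fun κ l => absMoment₂_colH_zero hwA κ l)
    (fun c e => isBlockPeriodic_tadpoleTableA_coarse hGcov hWcov c e)
    (fun c e => isBlockPeriodic_bubbleTableA_coarse hGcov hScov c e)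
    (fun c e b => absMoment₂_baseKer_tadpoleTableA G hG hW hδ2 c e b)
    (fun c e b => absMoment₂_baseKer_bubbleTableA G hG hS' hδs c e b) ((n : ℤ) • (-z)) μ ν
  show (1 / 2 : ℝ) * tadpole G (vertex2OfK K n Wf μ 0 ν z) - (1 / 2 : ℝ) * bubble G (vertexOfK K n S μ 0) (vertexOfK K n S ν z) = _
  rw [sub_eq_add_neg, ← neg_mul, tadpolePart_eq_dressedEntryP hG hGcov hK hδ hKcov hW hδ2 hWcov,
    bubblePart_eq_dressedEntryP hG hGcov hK hδ hKcov hS hδs hScov, ← hadd]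
  rfl

end Sandwich

/-! ## §2 The two placements: axial (landed) and «leg = column kernel» (the literal of record's) -/

section Instances

variable {n : ℕ} {G K : MKer (3 + 1) (Fib 3)} {C δ : ℝ} {S : Fin (3 + 1) → (Fin (3 + 1) → ℤ) → MKer (3 + 1) (Fib 3)} {Cs δs : ℝ}
  {Wf : Fin (3 + 1) → (Fin (3 + 1) → ℤ) → Fin (3 + 1) → (Fin (3 + 1) → ℤ) → MKer (3 + 1) (Fib 3)} {C2 δ2 : ℝ}

/-- [folklore] **THE AXIAL PLACEMENT** (consistency with the landed sandwich): `TPerfOf n K S W = hessKer (Π K Π) (vertexOfK K n (Πᵀ S)) W` — the bond-slot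
adjunction `AxialDressing.vertexOfK_coProj_eq`; so `PerfectFullSandwich.TPerfOf_vertex2OfK_eq_dressedEntryP` is §1 at `(G, S) := (axDressK n K, coProj n S)`. -/
theorem TPerfOf_eq_hessKer_coProj (hn : 1 ≤ n) (hK : Decays K C δ) (hδ : 0 < δ) (hS : LocStencil S Cs δs) (hδs : 0 < δs)
    (W : Fin (3 + 1) → (Fin (3 + 1) → ℤ) → Fin (3 + 1) → (Fin (3 + 1) → ℤ) → MKer (3 + 1) (Fib 3)) :
    TPerfOf n K S W = hessKer (axDressK n K) (vertexOfK K n (coProj n S)) W := by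
  unfold TPerfOf
  congr 1
  funext μ y
  exact (vertexOfK_coProj_eq hn hK hδ hS hδs.le μ y).symm

/-- [folklore] **THE «LEG = COLUMN KERNEL» PLACEMENT** (the literal of record's: `TbalOf Lc (JsB12Sym …) j = hessKer G_j (vertexOfK G_j Lc S⁰_j) W⁰_j`,
`SymmetrisedDressingHessian.TbalOf_dressSymAt`): for ANY decaying, coarse-translation-invariant `G` with absolutely summable column second moments,
`hessKer G (vertexOfK G n S) (vertex2OfK G n Wf) μ ν z = dressedEntryP (c a ↦ colH G n a 0 c) (fineHessA G S Wf) (n•(−z)) μ ν` — NO projector on the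
stencils, the dressing (whatever it is) lives inside `G`; the column letters are then owed for `colOf G`. -/
theorem hessKer_self_eq_dressedEntryP (hn : 1 ≤ n) (hG : Decays G C δ) (hδ : 0 < δ)
    (hGcov : ∀ t : Fin (3 + 1) → ℤ, shiftK (-((n : ℤ) • t)) G = G) (hwA : ∀ κ l : Fin 4, AbsMoment₂ (colOf G κ l))
    (hS : LocStencil S Cs δs) (hδs : 0 < δs) (hScov : ∀ κ u t, S κ (u + (n : ℤ) • t) = shiftK (-((n : ℤ) • t)) (S κ u))
    (hW : ∀ κ' u l' u', BiLoc (Wf κ' u l' u') u u' C2 δ2) (hδ2 : 0 < δ2)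
    (hWcov : ∀ κ' u l' u' t, Wf κ' (u + (n : ℤ) • t) l' (u' + (n : ℤ) • t) = shiftK (-((n : ℤ) • t)) (Wf κ' u l' u'))
    (μ ν : Fin (3 + 1)) (z : Fin (3 + 1) → ℤ) :
    hessKer G (vertexOfK G n S) (vertex2OfK G n Wf) μ ν z
      = dressedEntryP (fun c a => colH G n a 0 c) (fineHessA G S Wf) ((n : ℤ) • (-z)) μ ν :=
  hessKer_vertexOfK_vertex2OfK_eq_dressedEntryP hn ⟨C, δ, hδ, hG⟩ hGcov hG hδ hGcov hwA hS hδs hScov hW hδ2 hWcov μ ν z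

end Instances

end Summit.QuantumFields.BalabanUV.Beta.FP.GenericResolventSandwich

end
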